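import Literature.AlgebraicGeometry.Resolution.LogRegularSharpening
import HarnessLib

/-!
# Crux `FrobeniusLadder.FRationalResolution` (stmt-ResolutionOfSingularities-15317), line `redirect`,
# stub `stub_diagonalizableQuotientResolution` — monomial IDEAL membership modulo `θ` in `Λ⟦X⟧`
# (power-series core of Kato's regularity criterion, brick (θ) of the repair census)

In the completed picture `𝒪̂ ≅ Λ⟦P⟧/(θ)` of a log regular local ring (Kato 1994 (3.2); tree:
`LogRegularCompleteStructure.ker_eq_span_theta`) the tree proves the UNIT comparison of two monomials
(`LogRegularCompleteStructure.monomial_sub_mul_monomial_ne_theta_mul`: `x^w − ũ x^{w'} ∉ (θ)`, Nizioł 2006 Lemma 2.4 (1)).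
This file proves the IDEAL version needed for Kato's regularity criterion ("`𝒪` regular ⇒ the sharp stalk monoid is
free": a minimal generator `φ(q)` of Kato's ideal lying in the ideal of the other monomial generators would force
`q ∈ qⱼ + P`):

* `coeff_sum_mul_monomial_eq_zero_of_standard` — at a STANDARD exponent `b` (no `wⱼ ≤ b`) every combination
  `∑ cⱼ x^{wⱼ}` has coefficient `0`;
* **`monomial_sub_sum_mul_monomial_ne_theta_mul`** — if the constant coefficient of `θ` is a non-zero-divisor and not a
  unit and no `wⱼ` divides `x^w`, then `x^w − ∑ⱼ cⱼ x^{wⱼ} ≠ θ · g`: i.e. **`x^w ∉ (x^{w₁}, …, x^{w_k}, θ)` unless some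
  `wⱼ ≤ w`** (compare coefficients at a standard exponent of least degree in the support of `g`; exponents below a
  standard exponent are standard);
* `monomial_sub_sum_mul_monomial_ne_theta_mul_of_supported` — the same inside a monoid power-series ring `Λ⟦S⟧`
  (`θ`, `cⱼ` supported on a submonoid `S`, standard = outside `⋃ⱼ (wⱼ + S)`): the form matching `𝒪̂ ≅ Λ⟦P'⟧/(θ)`.

Honest label: generic power-series lemma (no stub closed); the transport to a log regular local ring along the d-form
chart data of `LogRegularSharpening` / `LogChartEmbeddingRank` is NOT here. No definitions, no named facts, no sorry.
[cite: Kato1994, (3.2), (6.1)] [cite: Niziol2006, Lemma 2.4]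
-/

noncomputable section

-- single-problem summit: the doubled namespace component is forced
set_option linter.dupNamespace false

namespace Summit.ResolutionOfSingularities.ResolutionOfSingularities.Theorems.FRationalResolution.MonomialMembershipTheta

universe u

open MvPowerSeries

/-- At a standard exponent `b` (no `wⱼ ≤ b`), `∑ⱼ cⱼ x^{wⱼ}` has coefficient zero. [folklore] -/
theorem coeff_sum_mul_monomial_eq_zero_of_standard {σ : Type*} {Λ : Type u} [CommRing Λ] {ι : Type*}
    (t : Finset ι) (c : ι → MvPowerSeries σ Λ) (wj : ι → σ →₀ ℕ) {b : σ →₀ ℕ}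
    (hb : ∀ j ∈ t, ¬ wj j ≤ b) :
    MvPowerSeries.coeff b (∑ j ∈ t, c j * MvPowerSeries.monomial (wj j) (1 : Λ)) = 0 := by
  classical
  rw [map_sum]
  refine Finset.sum_eq_zero fun j hj => ?_
  rw [MvPowerSeries.coeff_mul_monomial, if_neg (hb j hj)]

/-- **Monomial ideal membership modulo `θ`.** In `Λ⟦Xᵢ⟧`, let `θ` have constant coefficient a non-zero-divisor which is
not a unit, and let `w, w₁, …, w_k` be exponents with NO `wⱼ ≤ w`. Then `x^w − ∑ⱼ cⱼ x^{wⱼ} ≠ θ · g` for all `cⱼ, g`: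
the monomial `x^w` does not lie in the ideal `(x^{w₁}, …, x^{w_k}, θ)`. (At a standard exponent `b₀` of least degree in
the support of `g` — exponents below a standard one are standard — the coefficient of `θ g` is `θ(0) g(b₀)`, while the
left-hand side has coefficient `[b₀ = w]`.) [cite: Kato1994, (3.2)] [cite: Niziol2006, Lemma 2.4] -/
theorem monomial_sub_sum_mul_monomial_ne_theta_mul {σ : Type*} {Λ : Type u} [CommRing Λ] {ι : Type*}
    (θ g : MvPowerSeries σ Λ) (hπ : MvPowerSeries.constantCoeff θ ∈ nonZeroDivisors Λ)
    (hπu : ¬IsUnit (MvPowerSeries.constantCoeff θ))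
    (t : Finset ι) (c : ι → MvPowerSeries σ Λ) (wj : ι → σ →₀ ℕ) {w : σ →₀ ℕ}
    (hw : ∀ j ∈ t, ¬ wj j ≤ w) :
    MvPowerSeries.monomial w (1 : Λ) - ∑ j ∈ t, c j * MvPowerSeries.monomial (wj j) 1 ≠ θ * g := by
  classical
  intro heq
  have hnt : Nontrivial Λ := by
    by_contra h
    haveI := not_nontrivial_iff_subsingleton.1 h
    exact hπu (isUnit_of_subsingleton _)
  -- standard exponents and the left-hand side there
  have hstd_le : ∀ {b b' : σ →₀ ℕ}, b' ≤ b → (∀ j ∈ t, ¬ wj j ≤ b) → ∀ j ∈ t, ¬ wj j ≤ b' :=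
    fun hb'b hb j hj hle => hb j hj (hle.trans hb'b)
  have hL : ∀ b : σ →₀ ℕ, (∀ j ∈ t, ¬ wj j ≤ b) →
      MvPowerSeries.coeff b (MvPowerSeries.monomial w (1 : Λ) - ∑ j ∈ t, c j * MvPowerSeries.monomial (wj j) 1)
        = if b = w then 1 else 0 := by
    intro b hb
    rw [map_sub, coeff_sum_mul_monomial_eq_zero_of_standard t c wj hb, sub_zero, MvPowerSeries.coeff_monomial]
  -- the coefficient of `θ g` at an exponent all of whose proper lower exponents are off the support of `g`
  have hcoeffθ : ∀ v : σ →₀ ℕ, (∀ b : σ →₀ ℕ, b ≤ v → b ≠ v → MvPowerSeries.coeff b g = 0) →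
      MvPowerSeries.coeff v (θ * g) = MvPowerSeries.constantCoeff θ * MvPowerSeries.coeff v g := by
    intro v hv
    rw [MvPowerSeries.coeff_mul, Finset.sum_eq_single (0, v)]
    · rw [MvPowerSeries.coeff_zero_eq_constantCoeff]
    · rintro ⟨a, b⟩ hab hne
      rw [Finset.HasAntidiagonal.mem_antidiagonal] at hab
      simp only at hab
      have ha0 : a ≠ 0 := by
        rintro rfl; rw [zero_add] at hab; exact hne (by rw [hab])
      have hble : b ≤ v := by rw [← hab]; exact le_add_self
      have hbne : b ≠ v := by
        intro hbv
        apply ha0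
        have := congrArg (fun x => x - b) hab
        simp only [hbv, add_tsub_cancel_right, tsub_self] at this
        exact this
      simp only
      rw [hv b hble hbne, mul_zero]
    · intro h
      exact (h (Finset.HasAntidiagonal.mem_antidiagonal.2 (zero_add v))).elim
  -- is there a STANDARD exponent in the support of `g`?
  by_cases hex : ∃ m : ℕ, ∃ v : σ →₀ ℕ, v.degree = m ∧ (∀ j ∈ t, ¬ wj j ≤ v) ∧ MvPowerSeries.coeff v g ≠ 0
  · -- a standard exponent of least degree in the support
    let m₀ := Nat.find hex
    obtain ⟨v₀, hv₀deg, hv₀std, hv₀⟩ :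
        ∃ v, v.degree = m₀ ∧ (∀ j ∈ t, ¬ wj j ≤ v) ∧ MvPowerSeries.coeff v g ≠ 0 := Nat.find_spec hex
    have hmin : ∀ v : σ →₀ ℕ, v.degree < m₀ → (∀ j ∈ t, ¬ wj j ≤ v) → MvPowerSeries.coeff v g = 0 := by
      intro v hv hvstd
      by_contra hne
      exact Nat.find_min hex hv ⟨v, rfl, hvstd, hne⟩
    have hθv₀ : MvPowerSeries.coeff v₀ (θ * g) =
        MvPowerSeries.constantCoeff θ * MvPowerSeries.coeff v₀ g :=
      hcoeffθ v₀ fun b hb hne => hmin b (by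
        rw [← hv₀deg]
        obtain ⟨d, rfl⟩ := exists_add_of_le hb
        have hd0 : d ≠ 0 := by rintro rfl; exact hne (by rw [add_zero])
        rw [map_add]
        have : 0 < d.degree := by
          rw [pos_iff_ne_zero, Ne, Finsupp.degree_eq_zero_iff]; exact hd0
        omega) (hstd_le hb hv₀std)
    have h1 := congrArg (MvPowerSeries.coeff v₀) heq
    rw [hL v₀ hv₀std, hθv₀] at h1
    split_ifs at h1 with hvw
    · -- `1 = θ(0) g(v₀)`: `θ(0)` would be a unit
      exact hπu (isUnit_of_mul_isUnit_left (by rw [← h1]; exact isUnit_one))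
    · exact hv₀ ((mul_left_mem_nonZeroDivisors_eq_zero_iff hπ).1 h1.symm)
  · -- no standard exponent in the support: compare at `w` (standard)
    push Not at hex
    have hzero : ∀ v : σ →₀ ℕ, (∀ j ∈ t, ¬ wj j ≤ v) → MvPowerSeries.coeff v g = 0 :=
      fun v hv => hex v.degree v rfl hv
    have hθw : MvPowerSeries.coeff w (θ * g) = MvPowerSeries.constantCoeff θ * MvPowerSeries.coeff w g :=
      hcoeffθ w fun b hb _ => hzero b (hstd_le hb hw)
    have h1 := congrArg (MvPowerSeries.coeff w) heq
    rw [hL w hw, if_pos rfl, hθw, hzero w hw, mul_zero] at h1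
    exact one_ne_zero h1

/-- **Monomial ideal membership modulo `θ` in a MONOID power-series ring `Λ⟦S⟧`** (the form needed for Kato's
regularity criterion, where `𝒪̂ ≅ Λ⟦P'⟧/(θ)` for the EMBEDDED monoid `P' ⊆ ℕ^M`, not for `ℕ^M` itself): if `θ` and
the coefficients `cⱼ` are supported on a submonoid `S ⊆ ℕ^{(σ)}`, the constant coefficient of `θ` is a non-unit
non-zero-divisor, and `w ∉ wⱼ + S` for every `j`, then `x^w − ∑ⱼ cⱼ x^{wⱼ} ≠ θ · g` (for ANY `g`): standard exponents
are now those outside `⋃ⱼ (wⱼ + S)`, and an exponent `b ≤ v` with `v − b ∈ S` below a standard `v` is standard.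
[cite: Kato1994, (3.2)] [cite: Niziol2006, Lemma 2.4] -/
theorem monomial_sub_sum_mul_monomial_ne_theta_mul_of_supported {σ : Type*} {Λ : Type u} [CommRing Λ]
    {ι : Type*} (S : AddSubmonoid (σ →₀ ℕ))
    (θ g : MvPowerSeries σ Λ) (hθS : ∀ a : σ →₀ ℕ, a ∉ S → MvPowerSeries.coeff a θ = 0)
    (hπ : MvPowerSeries.constantCoeff θ ∈ nonZeroDivisors Λ)
    (hπu : ¬IsUnit (MvPowerSeries.constantCoeff θ))
    (t : Finset ι) (c : ι → MvPowerSeries σ Λ) (hcS : ∀ j ∈ t, ∀ a : σ →₀ ℕ, a ∉ S → MvPowerSeries.coeff a (c j) = 0)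
    (wj : ι → σ →₀ ℕ) {w : σ →₀ ℕ}
    (hw : ∀ j ∈ t, ∀ s ∈ S, w ≠ wj j + s) :
    MvPowerSeries.monomial w (1 : Λ) - ∑ j ∈ t, c j * MvPowerSeries.monomial (wj j) 1 ≠ θ * g := by
  classical
  intro heq
  have hnt : Nontrivial Λ := by
    by_contra h
    haveI := not_nontrivial_iff_subsingleton.1 h
    exact hπu (isUnit_of_subsingleton _)
  -- standard exponents: `b ∉ wⱼ + S`; below a standard exponent along `S` everything is standard
  have hstd_le : ∀ {b b' : σ →₀ ℕ}, b' ≤ b → b - b' ∈ S → (∀ j ∈ t, ∀ s ∈ S, b ≠ wj j + s) →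
      ∀ j ∈ t, ∀ s ∈ S, b' ≠ wj j + s := by
    intro b b' hb'b hS hb j hj s hs hEq
    apply hb j hj (s + (b - b')) (S.add_mem hs hS)
    rw [← add_assoc, ← hEq, add_tsub_cancel_of_le hb'b]
  have hL : ∀ b : σ →₀ ℕ, (∀ j ∈ t, ∀ s ∈ S, b ≠ wj j + s) →
      MvPowerSeries.coeff b (MvPowerSeries.monomial w (1 : Λ) - ∑ j ∈ t, c j * MvPowerSeries.monomial (wj j) 1)
        = if b = w then 1 else 0 := by
    intro b hb
    rw [map_sub, MvPowerSeries.coeff_monomial, map_sum, Finset.sum_eq_zero, sub_zero]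
    intro j hj
    rw [MvPowerSeries.coeff_mul_monomial]
    split_ifs with hle
    · rw [hcS j hj (b - wj j) (fun hs => hb j hj (b - wj j) hs (by rw [add_tsub_cancel_of_le hle])),
        zero_mul]
    · rfl
  -- the coefficient of `θ g` at `v` when `g` vanishes at the exponents `b < v` with `v - b ∈ S`
  have hcoeffθ : ∀ v : σ →₀ ℕ, (∀ b : σ →₀ ℕ, b ≤ v → b ≠ v → v - b ∈ S → MvPowerSeries.coeff b g = 0) →
      MvPowerSeries.coeff v (θ * g) = MvPowerSeries.constantCoeff θ * MvPowerSeries.coeff v g := by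
    intro v hv
    rw [MvPowerSeries.coeff_mul, Finset.sum_eq_single (0, v)]
    · rw [MvPowerSeries.coeff_zero_eq_constantCoeff]
    · rintro ⟨a, b⟩ hab hne
      rw [Finset.HasAntidiagonal.mem_antidiagonal] at hab
      simp only at hab
      have ha0 : a ≠ 0 := by
        rintro rfl; rw [zero_add] at hab; exact hne (by rw [hab])
      have hble : b ≤ v := by rw [← hab]; exact le_add_self
      have hvb : v - b = a := by rw [← hab, add_tsub_cancel_right]
      have hbne : b ≠ v := by
        intro hbv
        apply ha0
        rw [← hvb, hbv, tsub_self]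
      simp only
      by_cases haS : a ∈ S
      · rw [hv b hble hbne (hvb ▸ haS), mul_zero]
      · rw [hθS a haS, zero_mul]
    · intro h
      exact (h (Finset.HasAntidiagonal.mem_antidiagonal.2 (zero_add v))).elim
  by_cases hex : ∃ m : ℕ, ∃ v : σ →₀ ℕ, v.degree = m ∧ (∀ j ∈ t, ∀ s ∈ S, v ≠ wj j + s) ∧
      MvPowerSeries.coeff v g ≠ 0
  · let m₀ := Nat.find hex
    obtain ⟨v₀, hv₀deg, hv₀std, hv₀⟩ :
        ∃ v, v.degree = m₀ ∧ (∀ j ∈ t, ∀ s ∈ S, v ≠ wj j + s) ∧ MvPowerSeries.coeff v g ≠ 0 :=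
      Nat.find_spec hex
    have hmin : ∀ v : σ →₀ ℕ, v.degree < m₀ → (∀ j ∈ t, ∀ s ∈ S, v ≠ wj j + s) →
        MvPowerSeries.coeff v g = 0 := by
      intro v hv hvstd
      by_contra hne
      exact Nat.find_min hex hv ⟨v, rfl, hvstd, hne⟩
    have hθv₀ : MvPowerSeries.coeff v₀ (θ * g) =
        MvPowerSeries.constantCoeff θ * MvPowerSeries.coeff v₀ g :=
      hcoeffθ v₀ fun b hb hne hS => hmin b (by
        rw [← hv₀deg]
        obtain ⟨d, rfl⟩ := exists_add_of_le hb
        have hd0 : d ≠ 0 := by rintro rfl; exact hne (by rw [add_zero])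
        rw [map_add]
        have : 0 < d.degree := by
          rw [pos_iff_ne_zero, Ne, Finsupp.degree_eq_zero_iff]; exact hd0
        omega) (hstd_le hb hS hv₀std)
    have h1 := congrArg (MvPowerSeries.coeff v₀) heq
    rw [hL v₀ hv₀std, hθv₀] at h1
    split_ifs at h1 with hvw
    · exact hπu (isUnit_of_mul_isUnit_left (by rw [← h1]; exact isUnit_one))
    · exact hv₀ ((mul_left_mem_nonZeroDivisors_eq_zero_iff hπ).1 h1.symm)
  · push Not at hex
    have hzero : ∀ v : σ →₀ ℕ, (∀ j ∈ t, ∀ s ∈ S, v ≠ wj j + s) → MvPowerSeries.coeff v g = 0 :=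
      fun v hv => hex v.degree v rfl hv
    have hθw : MvPowerSeries.coeff w (θ * g) = MvPowerSeries.constantCoeff θ * MvPowerSeries.coeff w g :=
      hcoeffθ w fun b hb _ hS => hzero b (hstd_le hb hS hw)
    have h1 := congrArg (MvPowerSeries.coeff w) heq
    rw [hL w hw, if_pos rfl, hθw, hzero w hw, mul_zero] at h1
    exact one_ne_zero h1

end Summit.ResolutionOfSingularities.ResolutionOfSingularities.Theorems.FRationalResolution.MonomialMembershipTheta

end
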